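import Summits.BirchSwinnertonDyer.Rank1Residual.X12.O11.RouteUBernoulliCertificate
import Summits.BirchSwinnertonDyer.Rank1Residual.X12.O11.RouteUPsiD11
import Mathlib.NumberTheory.LegendreSymbol.Basic
import HarnessLib

/-!
# O11 at `p = 7`, ROUTE U — T-U4 for the first member `D = −11` (curve `5929e1 = 49a1^{(−11)}`,
# auxiliary `d'' = −19`): both Bernoulli numbers of (H-B) are `7`-adic UNITS, by kernel certificate

HONEST FRAMING (cell `bsd-cm`, run/shared/lean/pub/bsd-cm/, verbatim): the programme isolates, for
CM elliptic curves over `ℚ` of analytic rank `≤ 1`, classes on which the FULL BSD formula is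
reduced — strictly by PUBLISHED theorems entering as named-fact binders — to ONE local problem at
ONE prime, and then TYPES that residual problem. Seat `bsd-cm-ram` (generation 3); planner's T-U4
(TARGET §2: per-member certificates of (H-B); «T-U4 (D = −11)» in the g5 closing line).
THEOREMS ONLY; nothing booked (the cell books nothing on numerics; this is a kernel certificate).

## What is here

For `E_D = 49a1^{(D)}`, `D = −11`, `d'' = −19`, (H-B) of THEOREM U reads
`7 ∤ β₁ = B_{1,ω⁴χ_{−11}}` and `7 ∤ β₂ = B_{1,ωχ_{−11}χ_{−19}}` (memo ROUTE-U §2; two-engine numerics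
j237665/j238025: v₇ = 0, 0). Here `χ_{−11} = (·/11)`, `χ_{−19} = (·/19)` (Kronecker = Legendre
since `−11, −19 ≡ 1 (mod 4)`), `ω` the Teichmüller character mod `7`. This file PROVES, for ANY
`ℚ₇`-valued Dirichlet character `ω` mod `7` with `ω(a) ≡ a (mod 7)` (`IsTeichmullerCharacter ω`)
and ANY characters `θ₁` mod `77`, `θ₂` mod `1463` with the displayed values
`θ₁(j) = (j/11)·ω(j)⁴`, `θ₂(j) = (j/11)(j/19)·ω(j)`:

* `norm_generalizedBernoulli_theta1_D11 : ‖B_{1,θ₁}‖₇ = 1`, `norm_generalizedBernoulli_theta2_D11 :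
  ‖B_{1,θ₂}‖₇ = 1` — by `RouteU.norm_generalizedBernoulli_one_eq_one_of_cert` with the INTEGER
  certificates `S₁ = Σ_{j<77} (j/11)·j²⁹`, `S₂ = Σ_{j<1463} (j/11)(j/19)·j⁸` (`7 ∥ S₁`, `7 ∥ S₂`,
  checked by `decide` on Euler's criterion) and the Teichmüller congruence `ω(j)ᵏ ≡ j^{7k} (mod 49)`;
* generic plumbing `legendreSym_eq_ite` (Euler's criterion as a kernel-computable table) and
  `norm_sub_le_of_values` (values `c(j)·ω(j)ᵏ` ⇒ the certificate's approximation hypothesis).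

* `norm_bernoulliOnePrim_teichmuller_seven : ‖B_{1,ω}‖₇ = 1` for every Teichmüller `ω` mod `7`
  (certificate `Σ_{j<7} j⁸ = 7·306085`, `7 ∤ 306085`) — Rubin's `χ = 1` factor, used by the twin side;
* `bernoulli_hypothesis_D11` — (H-B) ASSEMBLED (planner's T-U4 for `D = −11`): for ANY Teichmüller `ω`,
  ANY Legendre-valued `χ` mod `11` and `ε` mod `19`, with `ψ := χ↑·(ω²)↑` mod `77`:
  `¬ ‖bernoulliOnePrim (bernoulliCharOne ψ ε) · bernoulliOnePrim (bernoulliCharTwo ψ ε ω)‖₇ ≤ 7⁻¹` — the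
  binder `hB` of `KrizLi2019.thm120_padicLogHeegner_unit_of_bernoulli` / `RouteU.bsdp_of_thm120_of_rem310`,
  from `RouteUPsiD11` (identification `bernoulliCharOne ψ ε = θ₁↑`, `bernoulliCharTwo ψ ε ω = θ₂↑`, values,
  primitivity) and `RouteUBernoulliCertificate.bernoulli_hypothesis_of_certs`. No numerics enter.

With `RouteU.bernoulli_hypothesis_of_certs` these give the Bernoulli hypothesis `hB` of
`KrizLi2019.thm120_…` / `RouteU.bsdp_of_thm120_of_rem310` for `D = −11` once `ψ = χ_{−11}ω²`
and `ε_{K''} = χ_{−19}` are written as characters (`bernoulliCharOne ψ ε = lift of ψ⁻¹ = θ₁`,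
`bernoulliCharTwo ψ ε ω = lift of θ₂`) — the character algebra is `RouteUPsiD11`; §5 assembles it. The `Fact (Nat.Prime 7/11/19)`
instances are those of `RouteUPsiD11`.
References: [KrizLi2019] Thm. 1.20 (p. 8), §1.5 (1); [Washington1997] §5.1, Thm. 4.2.
-/

noncomputable section

open scoped Classical
open DirichletCharacter Literature.NumberTheory.LFunctions Literature.NumberTheory.EllipticCurves.KrizLi2019

namespace Summit.BirchSwinnertonDyer.Rank1Residual.X12.O11.RouteU

/-! ## §1 Generic plumbing -/

/-- **Euler's criterion as a computable table**: for an odd prime `p`,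
`(a/p) = [a ≡ 0] ? 0 : ([a^{(p−1)/2} ≡ 1] ? 1 : −1)`. [folklore] -/
theorem legendreSym_eq_ite (p : ℕ) [Fact p.Prime] (hp2 : p ≠ 2) (a : ℤ) :
    legendreSym p a =
      if (a : ZMod p) = 0 then 0 else if (a : ZMod p) ^ (p / 2) = 1 then 1 else -1 := by
  by_cases ha : (a : ZMod p) = 0
  · rw [if_pos ha, (legendreSym.eq_zero_iff p a).mpr ha]
  · rw [if_neg ha]
    have hpow := legendreSym.eq_pow p a
    rcases legendreSym.eq_one_or_neg_one p ha with h | h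
    · rw [h] at hpow ⊢
      push_cast at hpow
      rw [if_pos hpow.symm]
    · rw [h] at hpow ⊢
      push_cast at hpow
      have hne : (a : ZMod p) ^ (p / 2) ≠ 1 := by
        rw [← hpow]
        intro h1
        have h2 : ((2 : ℕ) : ZMod p) = 0 := by
          have : (-1 : ZMod p) + 1 = 0 := by norm_num
          rw [h1] at this
          exact_mod_cast this
        rw [ZMod.natCast_eq_zero_iff] at h2
        exact hp2 ((Nat.prime_dvd_prime_iff_eq (Fact.out) Nat.prime_two).mp h2)
      rw [if_neg hne]

/-- **From values to the certificate's approximation hypothesis.** If a `ℚ_p`-valued character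
`θ` mod `n` has values `θ(j) = c(j)·ω(j)ᵏ` (`c` integer-valued, `ω` Teichmüller mod `p`, `k ≥ 1`),
then `‖θ(j) − c(j)·j^{pk}‖ ≤ p⁻²` for every `j` (`ω(j)ᵏ ≡ j^{pk} (mod p²)` for `p ∤ j`,
`KrizLi2019.IsTeichmullerCharacter.norm_pow_sub_pow_le`; for `p ∣ j` both sides are `≡ 0`).
[cite: Washington1997, §5.1 (Teichmüller character)] -/
theorem norm_sub_le_of_values {p n : ℕ} [hp : Fact p.Prime] (ω : DirichletCharacter ℚ_[p] p)
    (hω : IsTeichmullerCharacter ω) (θ : DirichletCharacter ℚ_[p] n) (c : ℕ → ℤ) (k : ℕ)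
    (hk : 1 ≤ k) (hθ : ∀ j : ZMod n, θ j = (c j.val : ℚ_[p]) * ω (j.val : ZMod p) ^ k)
    (j : ZMod n) :
    ‖θ j - (c j.val : ℚ_[p]) * (j.val : ℚ_[p]) ^ (p * k)‖ ≤ (p : ℝ) ^ (-2 : ℤ) := by
  rw [hθ j, ← mul_sub, norm_mul, pow_mul]
  have hc : ‖(c j.val : ℚ_[p])‖ ≤ 1 := Padic.norm_int_le_one _
  have hmain : ‖ω (j.val : ZMod p) ^ k - ((j.val : ℚ_[p]) ^ p) ^ k‖ ≤ (p : ℝ) ^ (-2 : ℤ) := by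
    by_cases hdvd : (p : ℤ) ∣ (j.val : ℤ)
    · -- `p ∣ j`: `ω(j) = ω(0) = 0` and `‖j^{pk}‖ ≤ p^{-pk} ≤ p^{-2}`
      have h0 : (j.val : ZMod p) = 0 := by
        rw [ZMod.natCast_eq_zero_iff]; exact_mod_cast hdvd
      rw [h0, MulChar.map_zero, zero_pow (by omega), zero_sub, norm_neg, ← pow_mul, norm_pow]
      have hj : ‖(j.val : ℚ_[p])‖ ≤ (p : ℝ) ^ (-1 : ℤ) := by
        have := (Padic.norm_int_le_pow_iff_dvd (j.val : ℤ) 1).mpr (by simpa using hdvd)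
        simpa using this
      have hp1 : (0 : ℝ) ≤ (p : ℝ) ^ (-1 : ℤ) := zpow_nonneg (Nat.cast_nonneg p) _
      calc ‖(j.val : ℚ_[p])‖ ^ (p * k) ≤ ((p : ℝ) ^ (-1 : ℤ)) ^ (p * k) :=
            pow_le_pow_left₀ (norm_nonneg _) hj _
        _ ≤ ((p : ℝ) ^ (-1 : ℤ)) ^ 2 := by
            apply pow_le_pow_of_le_one hp1
            · rw [zpow_neg_one]; exact inv_le_one_of_one_le₀ (by exact_mod_cast hp.out.one_lt.le)
            · nlinarith [hp.out.two_le]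
        _ = (p : ℝ) ^ (-2 : ℤ) := by rw [← zpow_natCast, ← zpow_mul]; norm_num
    · have := hω.norm_pow_sub_pow_le (j.val : ℤ) hdvd k
      push_cast at this
      exact this
  calc ‖(c j.val : ℚ_[p])‖ * ‖ω (j.val : ZMod p) ^ k - ((j.val : ℚ_[p]) ^ p) ^ k‖
      ≤ 1 * (p : ℝ) ^ (-2 : ℤ) := mul_le_mul hc hmain (norm_nonneg _) zero_le_one
    _ = (p : ℝ) ^ (-2 : ℤ) := one_mul _

/-- `ω(−1)⁴ = 1` for any character mod `7` (indeed `ω(−1)² = ω(1) = 1`). [folklore] -/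
theorem apply_neg_one_pow_four (ω : DirichletCharacter ℚ_[7] 7) : ω ((6 : ℕ) : ZMod 7) ^ 4 = 1 := by
  have h : ((6 : ℕ) : ZMod 7) * ((6 : ℕ) : ZMod 7) = 1 := by decide
  have h2 : ω ((6 : ℕ) : ZMod 7) ^ 2 = 1 := by rw [sq, ← map_mul, h, map_one]
  rw [show (4 : ℕ) = 2 * 2 by norm_num, pow_mul, h2, one_pow]

/-- `ord₇ 77 = 1`. [folklore] -/
theorem padicValNat_seven_77 : padicValNat 7 77 = 1 := by
  rw [show (77 : ℕ) = 7 * 11 by norm_num, padicValNat.mul (by norm_num) (by norm_num),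
    padicValNat_self, padicValNat.eq_zero_of_not_dvd (by norm_num)]

/-- `ord₇ 1463 = 1` (`1463 = 7·11·19`). [folklore] -/
theorem padicValNat_seven_1463 : padicValNat 7 (77 * 19) = 1 := by
  rw [show (77 * 19 : ℕ) = 7 * 209 by norm_num, padicValNat.mul (by norm_num) (by norm_num),
    padicValNat_self, padicValNat.eq_zero_of_not_dvd (by norm_num)]

/-! ## §2 `β₁(−11) = B_{1,ω⁴χ_{−11}}` is a `7`-adic unit -/

set_option maxRecDepth 200000 in
/-- **T-U4, `D = −11`, first Bernoulli number: `‖B_{1,θ₁}‖₇ = 1` for every `ℚ₇`-valued character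
`θ₁` mod `77` with values `θ₁(j) = (j/11)·ω(j)⁴`, `ω` Teichmüller** (for `49a1^{(−11)} = 5929e1`:
`θ₁ = ω⁴χ_{−11}`, `β₁ = B_{1,θ₁}`; two-engine numerics v₇(β₁) = 0). Certificate: `S₁ = Σ_{j<77}
(j/11)·j²⁹` has `7 ∥ S₁` (`decide`). [cite: KrizLi2019, Thm. 1.20 (p. 8) and §1.5 (1)]
[cite: Washington1997, §5.1 and Thm. 4.2] -/
theorem norm_generalizedBernoulli_theta1_D11 (ω : DirichletCharacter ℚ_[7] 7)
    (hω : IsTeichmullerCharacter ω) (θ : DirichletCharacter ℚ_[7] 77)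
    (hθ : ∀ j : ZMod 77, θ j = (legendreSym 11 (j.val : ℤ) : ℚ_[7]) * ω (j.val : ZMod 7) ^ 4) :
    ‖generalizedBernoulli 1 θ‖ = 1 := by
  -- `θ ≠ 1`: `θ(−1) = (−1/11)·ω(−1)⁴ = −1`
  have hθ1 : θ ≠ 1 := by
    intro h1
    have hv := hθ ((76 : ℕ) : ZMod 77)
    have hval : (((76 : ℕ) : ZMod 77)).val = 76 := by rw [ZMod.val_natCast]
    have h76 : ((76 : ℕ) : ZMod 7) = ((6 : ℕ) : ZMod 7) := by decide
    have hu : IsUnit ((76 : ℕ) : ZMod 77) := by decide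
    rw [h1, hval, MulChar.one_apply hu, h76, apply_neg_one_pow_four, mul_one] at hv
    have hL : legendreSym 11 ((76 : ℕ) : ℤ) = -1 := by
      rw [legendreSym_eq_ite 11 (by norm_num)]; decide
    rw [hL] at hv
    norm_num at hv
  refine norm_generalizedBernoulli_one_eq_one_of_cert θ hθ1 padicValNat_seven_77
    (fun j => legendreSym 11 (j.val : ℤ)) 28 (fun j => ?_) ?_ ?_
  · have := norm_sub_le_of_values ω hω θ (fun m => legendreSym 11 (m : ℤ)) 4 (by norm_num) hθ j
    simpa using this
  · simp_rw [legendreSym_eq_ite 11 (by norm_num)]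
    decide +kernel
  · simp_rw [legendreSym_eq_ite 11 (by norm_num)]
    decide +kernel

/-! ## §3 `β₂(−11, −19) = B_{1,ωχ_{−11}χ_{−19}}` is a `7`-adic unit -/

set_option maxRecDepth 200000 in
/-- **T-U4, `D = −11`, `d'' = −19`, second Bernoulli number: `‖B_{1,θ₂}‖₇ = 1` for every
`ℚ₇`-valued character `θ₂` mod `1463 = 7·11·19` with values `θ₂(j) = (j/11)(j/19)·ω(j)`,
`ω` Teichmüller** (`β₂ = B_{1,ωχ_{−11}χ_{−19}}`; two-engine numerics v₇(β₂) = 0). Certificate: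
`S₂ = Σ_{j<1463} (j/11)(j/19)·j⁸` has `7 ∥ S₂` (`decide`). [cite: KrizLi2019, Thm. 1.20 (p. 8) and §1.5 (1)]
[cite: Washington1997, §5.1 and Thm. 4.2] -/
theorem norm_generalizedBernoulli_theta2_D11 (ω : DirichletCharacter ℚ_[7] 7)
    (hω : IsTeichmullerCharacter ω) (θ : DirichletCharacter ℚ_[7] (77 * 19))
    (hθ : ∀ j : ZMod (77 * 19), θ j =
      ((legendreSym 11 (j.val : ℤ) * legendreSym 19 (j.val : ℤ) : ℤ) : ℚ_[7]) * ω (j.val : ZMod 7) ^ 1) :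
    ‖generalizedBernoulli 1 θ‖ = 1 := by
  -- `θ ≠ 1`: `θ(−1) = (−1/11)(−1/19)·ω(−1) = ω(−1)`, and `θ(2·1463/…)`… use `j = 3`:
  -- `(3/11) = 1`, `(3/19) = −1`, so `θ(3) = −ω(3)`; if `θ = 1` then `ω(3) = −1`, but
  -- `‖ω(3) − 3‖ < 1` forces `‖−1 − 3‖ = ‖−4‖ = 1 < 1`, absurd.
  have hθ1 : θ ≠ 1 := by
    intro h1
    have hv := hθ ((3 : ℕ) : ZMod (77 * 19))
    have hval : (((3 : ℕ) : ZMod (77 * 19))).val = 3 := by rw [ZMod.val_natCast]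
    have hu : IsUnit ((3 : ℕ) : ZMod (77 * 19)) := by
      rw [show ((3 : ℕ) : ZMod (77 * 19)) = ((ZMod.unitOfCoprime 3 (by norm_num) : (ZMod (77 * 19))ˣ) : ZMod (77 * 19))
        from rfl]
      exact Units.isUnit _
    rw [h1, hval, MulChar.one_apply hu, pow_one] at hv
    have hL : legendreSym 11 ((3 : ℕ) : ℤ) * legendreSym 19 ((3 : ℕ) : ℤ) = -1 := by
      rw [legendreSym_eq_ite 11 (by norm_num), legendreSym_eq_ite 19 (by norm_num)]; decide
    rw [hL] at hv
    push_cast at hv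
    have h3 : ω (3 : ZMod 7) = -1 := by linear_combination hv
    have hT := hω 3 (by decide)
    push_cast at hT
    rw [h3, show (-1 : ℚ_[7]) - 3 = -((4 : ℕ) : ℚ_[7]) by norm_num, norm_neg] at hT
    have h4 : ‖((4 : ℕ) : ℚ_[7])‖ = 1 := Padic.norm_natCast_eq_one_iff.mpr (by decide)
    rw [h4] at hT
    exact lt_irrefl _ hT
  refine norm_generalizedBernoulli_one_eq_one_of_cert θ hθ1 padicValNat_seven_1463
    (fun j => legendreSym 11 (j.val : ℤ) * legendreSym 19 (j.val : ℤ)) 7 (fun j => ?_) ?_ ?_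
  · have := norm_sub_le_of_values ω hω θ (fun m => legendreSym 11 (m : ℤ) * legendreSym 19 (m : ℤ))
      1 le_rfl hθ j
    simpa using this
  · simp_rw [legendreSym_eq_ite 11 (by norm_num), legendreSym_eq_ite 19 (by norm_num)]
    decide +kernel
  · simp_rw [legendreSym_eq_ite 11 (by norm_num), legendreSym_eq_ite 19 (by norm_num)]
    decide +kernel

/-! ## §4 `‖B_{1,ω}‖₇ = 1` (Rubin's `χ = 1` factor of Thm C, used on the twin side) -/

set_option maxRecDepth 20000 in
/-- **`B_{1,ω}` is a `7`-adic unit** for every Teichmüller character `ω` mod `7`: `ω` is primitive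
(`ω ≠ 1`, level prime) and the mod-`49` certificate is `Σ_{j<7} j⁸ = 2142595 = 7 · 306085` with
`7 ∤ 306085` (`B_{1,ω} ≡ 3 (mod 7)`). [cite: Washington1997, §5.1 and Thm. 4.2]
[cite: Rubin1983, §0 Thm. C (p. 341, the factor B_{1,χω^{(p−3)/4}} at χ = 1)] -/
theorem norm_bernoulliOnePrim_teichmuller_seven (ω : DirichletCharacter ℚ_[7] 7)
    (hω : IsTeichmullerCharacter ω) : ‖bernoulliOnePrim ω‖ = 1 := by
  have hω1 : ω ≠ 1 := fun h => teichmuller_sq_ne_one ω hω (by rw [h, one_pow])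
  have hprim : ω.IsPrimitive := conductor_eq_of_prime_of_ne_one ω hω1
  refine norm_bernoulliOnePrim_eq_one_of_cert (p := 7) ω hprim (by simp) (fun _ => 1) 7
    (fun j => ?_) ?_ ?_
  · have hθ : ∀ j : ZMod 7, ω j = ((fun _ : ℕ => (1 : ℤ)) j.val : ℚ_[7]) * ω (j.val : ZMod 7) ^ 1 :=
      fun j => by rw [ZMod.natCast_zmod_val, pow_one, Int.cast_one, one_mul]
    have := norm_sub_le_of_values ω hω ω (fun _ => 1) 1 le_rfl hθ j
    simpa using this
  · decide
  · decide

/-! ## §5 (H-B) for `D = −11` ASSEMBLED: the binder `hB` of Kriz–Li Thm. 1.20 / THEOREM U -/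

/-- **(H-B) for `D = −11`, `d'' = −19`, in the kernel**: the Bernoulli hypothesis of Kriz–Li
Thm. 1.20 for `ψ = χ_{−11}ω²`, `ε_K = χ_{−19}` holds for every Teichmüller `ω`.
[cite: KrizLi2019, Thm. 1.20 (p. 8)] -/
theorem bernoulli_hypothesis_D11 (ω : DirichletCharacter ℚ_[7] 7) (hω : IsTeichmullerCharacter ω)
    (χ : DirichletCharacter ℚ_[7] 11) (hχ : ∀ a : ℕ, χ (a : ZMod 11) = (legendreSym 11 (a : ℤ) : ℚ_[7]))
    (ε : DirichletCharacter ℚ_[7] 19) (hε : ∀ a : ℕ, ε (a : ZMod 19) = (legendreSym 19 (a : ℤ) : ℚ_[7])) :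
    ¬ ‖bernoulliOnePrim (bernoulliCharOne
          (changeLevel (by norm_num : 11 ∣ 77) χ * changeLevel (by norm_num : 7 ∣ 77) (ω ^ 2)) ε) *
        bernoulliOnePrim (bernoulliCharTwo
          (changeLevel (by norm_num : 11 ∣ 77) χ * changeLevel (by norm_num : 7 ∣ 77) (ω ^ 2)) ε ω)‖ ≤
      (7 : ℝ)⁻¹ := by
  haveI : NeZero (77 * 19) := ⟨by norm_num⟩
  haveI : NeZero (77 * 19 * 7) := ⟨by norm_num⟩
  have h := bernoulli_hypothesis_of_certs (p := 7)
    (changeLevel (by norm_num : 11 ∣ 77) χ * changeLevel (by norm_num : 7 ∣ 77) (ω ^ 2) :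
      DirichletCharacter ℚ_[7] 77)⁻¹
    (psiD11_inv_isPrimitive ω χ hω hχ) (dvd_mul_right 77 19)
    (changeLevel (by norm_num : 11 ∣ 77 * 19) χ * changeLevel (by norm_num : 19 ∣ 77 * 19) ε *
      changeLevel (by norm_num : 7 ∣ 77 * 19) ω : DirichletCharacter ℚ_[7] (77 * 19))
    (theta2D11_isPrimitive ω χ ε hω hχ hε) (dvd_mul_right (77 * 19) 7)
    _ (bernoulliCharOne_psiD11 ω χ ε hχ) _ (bernoulliCharTwo_psiD11 ω χ ε hχ)
    (norm_generalizedBernoulli_theta1_D11 ω hω _ (psiD11_inv_apply ω χ hχ))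
    (norm_generalizedBernoulli_theta2_D11 ω hω _ (theta2D11_apply ω χ ε hχ hε))
  exact_mod_cast h

end Summit.BirchSwinnertonDyer.Rank1Residual.X12.O11.RouteU

end
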